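import Summits.PneNP.PneNP.Theorems.PhaseTwinsNoFBPPApproxAboveUniquenessConjectureNode

/-!
# Skeleton v6 (line `SketchIdeator1`, card `stockmeyer-bpp-calibration`) for crux stmt-PneNP-2717
`Summit.PneNP.PneNP.Theses.PhaseTwins.NoFBPPApproxAboveUniqueness` (=: X) — NODE FORM

Lead: prover-line-stmt-PneNP-2717-c2-0 (re-audit HONEST-BET-1LEAF continuation of leads -0 / -1 / c1-0).

Everything provable on this line has LANDED (all `--supports stmt-PneNP-2717`):
* lever S0–S4′ (`…CounterSpec` p85806, `…TtFnEqAdFn` p85772, `…AccFEighth` p85874, `…CoinSplit` p85855,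
  `…LeverAssembly` p89089, `…Lever` p90750): `NP ⊆ BPP → ∀ N ∈ #P, HasFPRAS N` (oracle-free Stockmeyer);
* `#P`-membership of the hard-core count T1–T4′ (`…GraphCanon` p88375, `…IndepVerifier` p88404,
  `…MaxDegreeTest` p88563, `…SharpPAssembly` p89560, `…SharpP` p92328): `HardcoreCountSharpP`;
* fact-free corner FF2/FF0/FF3 (`…FprasDecider` p90219, `Theorems.stub_gapE3SATB` from crux 2721's line,
  `…FactFreeAssembly` p90591, `…FactFree` p90759): FPRASes above `λ_c` at every `Δ ≥ 3` give `NP ⊆ BPP`;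
* Theorem N (`Negative/FalseOfNPSubsetBPP` p92507): `NP ⊆ BPP → ¬X`;
* the CALIBRATION (`…Calibration` p93858): `X ↔ ¬(NP ⊆ BPP)`, both directions with NO named fact;
* lead c2 (2026-08-17): the conjecture NODE `Summit.PneNP.PneNP.NPNotSubsetBPP := ¬(NP ⊆ BPP)`
  (`Theorems/NPNotSubsetBPP.lean`, p137511) and its bridge/web (`…ConjectureNode.lean`, p137656:
  `X ↔ NPNotSubsetBPP`, `NPNotSubsetBPP → X`, `NPNotSubsetBPP → PneNP`, `NPNotSubsetPPoly / OWFExist / PRGExist →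
  NPNotSubsetBPP`, `NPNotSubsetBPP ↔ NP ≠ RP ↔ PH ≠ BPP ↔ SAT ∉ BPP`), after a faithfulness audit of the tree's `NP`/`BPP`
  (`Cruxes/…/AUDIT-c2.md`: the residual is the genuine open conjecture, no modelling artefact).

So the composition below concludes the crux BY NAME from exactly one stub, and that stub is now stated BY NAME as the
discharge theorem of the registered conjecture node: `NPNotSubsetBPP_holds : Summit.PneNP.PneNP.NPNotSubsetBPP` — the
open conjecture `NP ⊄ BPP` (⟺ `NP ≠ RP`), which implies the summit and is EQUIVALENT to the crux. No worker is briefed on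
it; the leaf is carried `blocked-on: Summit.PneNP.PneNP.NPNotSubsetBPP` (a proof of the conjecture would land as
`Theorems/NPNotSubsetBPPHolds.lean` with exactly this theorem name, closing this skeleton verbatim), and the planner may
re-type route PhaseTwins `--conditional-bridge --conditional-on NPNotSubsetBPP` with bridge
`noFBPPApproxAboveUniqueness_of_NPNotSubsetBPP`.
-/

set_option linter.dupNamespace false -- `Summit.PneNP.PneNP.…` is the layout-mandated namespace (summit = sub-problem)

namespace Summit.PneNP.PneNP.Theorems.NoFBPPApproxAboveUniqueness

open Literature.Computability.Complexity
open Summit.PneNP.PneNP.Theses.PhaseTwins (NoFBPPApproxAboveUniqueness)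

/-- **Stub (the open end, BY NAME).** The registered conjecture node `NP ⊄ BPP`
(`Summit.PneNP.PneNP.NPNotSubsetBPP`, `Theorems/NPNotSubsetBPP.lean`). OPEN CONJECTURE, equivalent to the crux itself
(`noFBPPApproxAboveUniqueness_iff_NPNotSubsetBPP`, p137656) and implying the summit (`pneNP_of_NPNotSubsetBPP`); registered
as the line's single remaining stub so that the composition concludes the crux by name. No worker is briefed on it.
[folklore] -/
theorem NPNotSubsetBPP_holds : Summit.PneNP.PneNP.NPNotSubsetBPP := by
  sorry

/-- **Composition (fact-free).** The crux from the conjecture node alone, by the landed bridge (p137656 over p93858). -/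
theorem NoFBPPApproxAboveUniqueness_of : NoFBPPApproxAboveUniqueness :=
  noFBPPApproxAboveUniqueness_of_NPNotSubsetBPP NPNotSubsetBPP_holds

end Summit.PneNP.PneNP.Theorems.NoFBPPApproxAboveUniqueness
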